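import Summits.QuantumFields.BalabanUV.T4Continuum.Support.AveragingDeficitLiftPeriodic

/-!
# AveragingDeficitDualResidual (T⁴ programme, node NE3, row NE3-R2, gen 2) — R2ᴱ OF THE NE3 ENERGY ROUTE FOR BAŁABAN'S
# NON-LINEAR AVERAGE ON THE TORUS: the coarse residual current of the average of a fine-critical periodic small-field
# configuration is bounded against EVERY periodic coarse `𝔲(N)` direction `φ` in the dual `ℓ²`/`ℓ¹` norms —
# `L^{d−4}|⟨J(V̄), φ⟩| ≤ wallConst·[‖∇_VF‖_{ℓ²}·C₂(d,L)‖φ‖_{ℓ²} + a²·C₁(d,L)‖φ‖_{ℓ¹}]` — β-per (`deficitDerivWallPer_holds`),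
# the residual pairing (`residualPairing_torus`) and the periodic lift (`exists_lift_periodic`) BY NAME

HONEST FRAMING (cell `pub-balaban`, T4-DAG PAGE 1; unit `b2b-balaban-t4-ne3r2-p1` = owner of BINDER-OWNERS row NE3-R2,
gen 2).  The cell's T4 target is the finite-torus continuum limit of the unit-scale averaged loop expectations — NOT
infinite volume, NO mass gap, NOT Clay, NOT summit progress.  `T4ConvexResponse.dualResidual_le` (R2ᴱ REDUCED) turns the
chain rule, fine criticality on fine tangent directions, the lift `TangentLift` and the wall `DefectDerivBound` into
`|D𝒜c(P u)[φ]| ≤ Λδ N(φ)`.  THIS FILE is that reduction for the ACTUAL non-linear non-abelian one-step average (42) on the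
torus, with every analytic input a THEOREM of this unit except FINE CRITICALITY, which enters as the hypothesis
`FineCritical` (the constrained minimiser is critical along every periodic face-supported `𝔲(N)` direction whose
push-forward is an admissible coarse direction — the dictionary item R0/Fermat of the record, NOT proved here).  All
[folklore], 0 sorry: §1 torus counting of direction norms — `norm_curl_le_four`, `curlL1_le_periodic`
(`‖d_Vψ‖_{ℓ¹} ≤ 2·#planes·‖ψ‖_{ℓ¹}`), `curlSq_le_periodic` (`‖d_Vψ‖²_{ℓ²} ≤ 8·#planes·‖ψ‖²_{ℓ²}`) for periodic `ψ` over one period;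
§2 norms of a face-supported direction over one period are the norms of its face values (`dirL1_faceSupported_eq`,
`dirSq_faceSupported_eq`: the block sum collapses to the face offset), hence for the lift `‖ψ‖_{ℓ¹} ≤ 2L^d‖φ‖_{ℓ¹}`,
`‖ψ‖²_{ℓ²} ≤ 4L^{2d}‖φ‖²_{ℓ²}`; §3 `coarseActionOf_vary_congr` (the coarse action sees a coarse direction field only at the
block corners), the hypothesis shape `FineCritical` with its non-vacuity witness `fineCritical_flat`, **`dualResidual_torus`**, and its
dual-`ℓ²` form `dualResidual_torus_l2` (`coarseL1_le_sqrt`: `‖φ‖_{ℓ¹} ≤ √(d·M^d)‖φ‖_{ℓ²}`, the `√vol` of `actionRate_of_energyRoute`).  NE3 ITSELF IS NOT PROVED: NE3(A) ⇐ ML ∧ R0 ∧ β ∧ γ with β, (γ1) now theorems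
and R0 (fine criticality), ML (tangent coercivity), (γ2)–(γ4) (energy-norm cost), δ as recorded in `t4/T4-EST-NE3-P2.md`
§0 (e); NE3 stays COND-free.
CITATION HEADER: no printed sentence is a hypothesis; the manuscripts under audit are not cited for any disputed step;
context: T. Bałaban, Commun. Math. Phys. **98** (1985) 17–51 [Balaban1985Averaging] ((42), (44), (45) pp. 23–24);
**102** (1985) 277–309 [Balaban1985Variational] ((26)–(27) p. 282, (75)–(76) p. 289, §E (115)–(121) p. 295).
PLACEMENT: `Summits/QuantumFields/BalabanUV/` (human rule 2026-08-19).  Record: HOME `t4/T4-EST-NE3-R2.md` v0.3.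
-/

set_option autoImplicit false

open scoped BigOperators Matrix Matrix.Norms.L2Operator Topology
open NormedSpace Finset Filter

namespace Summit.QuantumFields.BalabanUV.T4Continuum.AveragingDeficitDualResidual

open Literature.MathematicalPhysics.QuantumFieldTheory.Balaban1983to89
open B7Prop1Explicit B7Prop2Explicit MatrixLog UnitaryModel
open T4AveragingDeficitWall hiding Site Plane Plaq Bond
open T4AveragingDeficitWallBoundary (IsPeriodicCfg periodBox blockSites_periodBox sum_blocks_eq sum_periodBox_shift)
open T4AveragingDeficitNonAbelian (Ad_mul Ad_sub)
open AveragingDeficitTransport AveragingDeficitLocality AveragingDeficitNearIdentity AveragingDeficitSideDeriv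
open AveragingDeficitDerivCore AveragingDeficitDerivWallProof AveragingDeficitPeriodicCounting
open AveragingDeficitDerivWallPeriodic AveragingDeficitResidualPairing AveragingDeficitTransportCalc
open AveragingDeficitPushForwardLinear AveragingDeficitFaceWords AveragingDeficitLiftMap AveragingDeficitFaceLift
open AveragingDeficitLiftPeriodic

noncomputable section

variable {d : ℕ} {n : Type*} [Fintype n] [DecidableEq n]

local notation "𝕄" => Matrix n n ℂ
local notation "Site" => B7Prop1Explicit.Site
local notation "Plane" => T4AveragingDeficitWall.Plane

/-! ## §1 Direction norms of periodic directions over one period -/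

/-- `‖(d_Vψ)(z; μ,ν)‖ ≤ ‖ψ(z,μ)‖ + ‖ψ(z+e_μ,ν)‖ + ‖ψ(z+e_ν,μ)‖ + ‖ψ(z,ν)‖` on `U(N)` data. [folklore] -/
theorem norm_curl_le_four {V : Site d → Fin d → 𝕄ˣ} (hV : IsUnitaryCfg V) (ψ : Site d → Fin d → 𝕄) (z : Site d)
    (π : Plane d) :
    ‖curl V ψ (z, π)‖ ≤ ‖ψ z π.1.1‖ + ‖ψ (z + e π.1.1) π.1.2‖ + ‖ψ (z + e π.1.2) π.1.1‖ + ‖ψ z π.1.2‖ := by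
  rw [curl, ← dhol_plaqWord]
  refine (norm_dhol_le hV ψ z _).trans (le_of_eq ?_)
  simp only [plaqWord, lnorm_cons, lnorm_nil, ↓reduceIte, Bool.false_eq_true, Letter.vec_true, Letter.vec_false,
    add_zero]
  have e1 : z + e π.1.1 + e π.1.2 + -e π.1.1 = z + e π.1.2 := by abel
  rw [e1]
  have e3 : z + e π.1.2 + -e π.1.2 = z := by abel
  rw [e3]
  ring

omit [Fintype n] [DecidableEq n] in
/-- For nonnegative `f`, `f μ + f ν ≤ Σ_i f i`. [folklore] -/
theorem pair_le_sum {f : Fin d → ℝ} (hf : ∀ i, 0 ≤ f i) (π : Plane d) : f π.1.1 + f π.1.2 ≤ ∑ i, f i := by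
  classical
  have hne : π.1.1 ≠ π.1.2 := ne_of_lt π.2
  calc f π.1.1 + f π.1.2 = ∑ i ∈ ({π.1.1, π.1.2} : Finset (Fin d)), f i := by rw [Finset.sum_pair hne]
    _ ≤ ∑ i, f i := Finset.sum_le_sum_of_subset_of_nonneg (Finset.subset_univ _) fun i _ _ => hf i

/-- **`‖d_Vψ‖_{ℓ¹(period)} ≤ 2·#planes·‖ψ‖_{ℓ¹(period)}`** for a periodic direction over one period. [folklore] -/
theorem curlL1_le_periodic {V : Site d → Fin d → 𝕄ˣ} (hV : IsUnitaryCfg V) {ψ : Site d → Fin d → 𝕄} {N : ℕ} (hN : 1 ≤ N)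
    (hψ : IsPeriodicDir ψ (N : ℤ)) :
    curlL1 V ψ (periodBox N) ≤ 2 * Fintype.card (Plane d) * dirL1 ψ (periodBox N) := by
  unfold T4AveragingDeficitWall.curlL1 T4AveragingDeficitWall.dirL1
  have hf0 : ∀ i, 0 ≤ ∑ z ∈ periodBox N, ‖ψ z i‖ := fun i => Finset.sum_nonneg fun _ _ => norm_nonneg _
  have hshift : ∀ (i j : Fin d), ∑ z ∈ periodBox N, ‖ψ (z + e i) j‖ = ∑ z ∈ periodBox N, ‖ψ z j‖ := fun i j =>
    sum_periodBox_shift N hN (g := fun z => ‖ψ z j‖) (fun x κ => by rw [hψ x κ j]) (e i)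
  rw [Finset.sum_comm]
  calc ∑ π : Plane d, ∑ z ∈ periodBox N, ‖curl V ψ (z, π)‖
      ≤ ∑ π : Plane d, ∑ z ∈ periodBox N,
          (‖ψ z π.1.1‖ + ‖ψ (z + e π.1.1) π.1.2‖ + ‖ψ (z + e π.1.2) π.1.1‖ + ‖ψ z π.1.2‖) :=
        Finset.sum_le_sum fun π _ => Finset.sum_le_sum fun z _ => norm_curl_le_four hV ψ z π
    _ = ∑ π : Plane d, (2 * ∑ z ∈ periodBox N, ‖ψ z π.1.1‖ + 2 * ∑ z ∈ periodBox N, ‖ψ z π.1.2‖) := by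
        refine Finset.sum_congr rfl fun π _ => ?_
        simp only [Finset.sum_add_distrib, hshift]
        ring
    _ ≤ ∑ _π : Plane d, 2 * ∑ i, ∑ z ∈ periodBox N, ‖ψ z i‖ :=
        Finset.sum_le_sum fun π _ => by
          have hp := pair_le_sum (f := fun i => ∑ z ∈ periodBox N, ‖ψ z i‖) hf0 π
          linarith
    _ = 2 * Fintype.card (Plane d) * ∑ z ∈ periodBox N, ∑ κ, ‖ψ z κ‖ := by
        rw [Finset.sum_const, Finset.card_univ, nsmul_eq_mul, Finset.sum_comm]; ring

/-- **`‖d_Vψ‖²_{ℓ²(period)} ≤ 8·#planes·‖ψ‖²_{ℓ²(period)}`** for a periodic direction over one period. [folklore] -/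
theorem curlSq_le_periodic {V : Site d → Fin d → 𝕄ˣ} (hV : IsUnitaryCfg V) {ψ : Site d → Fin d → 𝕄} {N : ℕ} (hN : 1 ≤ N)
    (hψ : IsPeriodicDir ψ (N : ℤ)) :
    curlSq V ψ (periodBox N) ≤ 8 * Fintype.card (Plane d) * dirSq ψ (periodBox N) := by
  unfold T4AveragingDeficitWall.curlSq T4AveragingDeficitWall.dirSq
  have hf0 : ∀ i, 0 ≤ ∑ z ∈ periodBox N, ‖ψ z i‖ ^ 2 := fun i => Finset.sum_nonneg fun _ _ => sq_nonneg _
  have hshift : ∀ (i j : Fin d), ∑ z ∈ periodBox N, ‖ψ (z + e i) j‖ ^ 2 = ∑ z ∈ periodBox N, ‖ψ z j‖ ^ 2 :=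
    fun i j => sum_periodBox_shift N hN (g := fun z => ‖ψ z j‖ ^ 2) (fun x κ => by rw [hψ x κ j]) (e i)
  have hsq : ∀ (a b c e' : ℝ), (a + b + c + e') ^ 2 ≤ 4 * (a ^ 2 + b ^ 2 + c ^ 2 + e' ^ 2) := fun a b c e' => by
    nlinarith [sq_nonneg (a - b), sq_nonneg (a - c), sq_nonneg (a - e'), sq_nonneg (b - c), sq_nonneg (b - e'),
      sq_nonneg (c - e')]
  rw [Finset.sum_comm]
  calc ∑ π : Plane d, ∑ z ∈ periodBox N, ‖curl V ψ (z, π)‖ ^ 2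
      ≤ ∑ π : Plane d, ∑ z ∈ periodBox N,
          4 * (‖ψ z π.1.1‖ ^ 2 + ‖ψ (z + e π.1.1) π.1.2‖ ^ 2 + ‖ψ (z + e π.1.2) π.1.1‖ ^ 2 + ‖ψ z π.1.2‖ ^ 2) :=
        Finset.sum_le_sum fun π _ => Finset.sum_le_sum fun z _ =>
          (pow_le_pow_left₀ (norm_nonneg _) (norm_curl_le_four hV ψ z π) 2).trans (hsq _ _ _ _)
    _ = ∑ π : Plane d, (8 * ∑ z ∈ periodBox N, ‖ψ z π.1.1‖ ^ 2 + 8 * ∑ z ∈ periodBox N, ‖ψ z π.1.2‖ ^ 2) := by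
        refine Finset.sum_congr rfl fun π _ => ?_
        rw [← Finset.mul_sum]
        simp only [Finset.sum_add_distrib, hshift]
        ring
    _ ≤ ∑ _π : Plane d, 8 * ∑ i, ∑ z ∈ periodBox N, ‖ψ z i‖ ^ 2 :=
        Finset.sum_le_sum fun π _ => by
          have hp := pair_le_sum (f := fun i => ∑ z ∈ periodBox N, ‖ψ z i‖ ^ 2) hf0 π
          linarith
    _ = 8 * Fintype.card (Plane d) * ∑ z ∈ periodBox N, ∑ κ, ‖ψ z κ‖ ^ 2 := by
        rw [Finset.sum_const, Finset.card_univ, nsmul_eq_mul, Finset.sum_comm]; ring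

/-! ## §2 Norms of a face-supported direction over one period -/

/-- The face offset `(L−1)·δ_i ∈ [0,L)^d`. [folklore] -/
def faceOff (L : ℕ) (hL : 1 ≤ L) (i : Fin d) : Fin d → Fin L := fun j => if j = i then ⟨L - 1, by omega⟩ else ⟨0, hL⟩

omit [Fintype n] [DecidableEq n] in
/-- `Ly + boxVec (faceOff i) = b₀(y, i)`. [folklore] -/
theorem smul_add_boxVec_faceOff {L : ℕ} (hL : 1 ≤ L) (y : Site d) (i : Fin d) :
    (L : ℤ) • y + boxVec L (faceOff L hL i) = faceSite L y i := by
  simp only [faceSite]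
  congr 1
  funext j
  simp only [boxVec, faceOff, Pi.smul_apply, e_apply, smul_eq_mul, mul_ite, mul_one, mul_zero]
  by_cases h : j = i
  · rw [if_pos h, if_pos h]
    push_cast [Nat.cast_sub hL]
    ring
  · rw [if_neg h, if_neg h]
    simp

omit [Fintype n] [DecidableEq n] in
/-- In a block only the face offset carries a face bond in direction `i`. [folklore] -/
theorem eq_faceOff_of_isFaceBond {L : ℕ} (hL : 1 ≤ L) (y : Site d) (i : Fin d) {r : Fin d → Fin L}
    (hf : IsFaceBond L ((L : ℤ) • y + boxVec L r) i) : r = faceOff L hL i := by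
  obtain ⟨y', hy'⟩ := hf
  funext j
  have hb := boxVec_bounds L r j
  have key := face_coord hL hy' j hb.1 hb.2
  simp only [boxVec] at key
  apply Fin.ext
  by_cases h : j = i
  · rw [if_pos h] at key
    simp only [faceOff, if_pos h]
    omega
  · rw [if_neg h] at key
    simp only [faceOff, if_neg h]
    omega

/-- The `ℓ¹` norm of a face-supported direction over one period is the sum of its face values. [folklore] -/
theorem dirL1_faceSupported_eq {L : ℕ} (hL : 1 ≤ L) (M : ℕ) {ψ : Site d → Fin d → 𝕄} (hψ : FaceSupported L ψ) :
    dirL1 ψ (periodBox (L * M)) = ∑ y ∈ periodBox M, ∑ κ : Fin d, ‖ψ (faceSite L y κ) κ‖ := by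
  unfold T4AveragingDeficitWall.dirL1
  rw [← blockSites_periodBox L M hL, ← sum_blocks_eq L hL (periodBox M) (fun z => ∑ κ : Fin d, ‖ψ z κ‖)]
  refine Finset.sum_congr rfl fun y _ => ?_
  rw [Finset.sum_comm]
  refine Finset.sum_congr rfl fun κ _ => ?_
  rw [Finset.sum_eq_single (faceOff L hL κ)]
  · rw [smul_add_boxVec_faceOff hL]
  · intro r _ hr
    rw [hψ _ _ fun hf => hr (eq_faceOff_of_isFaceBond hL y κ hf), norm_zero]
  · intro h; exact absurd (Finset.mem_univ _) h

/-- The squared `ℓ²` norm of a face-supported direction over one period is the sum of its squared face values. [folklore] -/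
theorem dirSq_faceSupported_eq {L : ℕ} (hL : 1 ≤ L) (M : ℕ) {ψ : Site d → Fin d → 𝕄} (hψ : FaceSupported L ψ) :
    dirSq ψ (periodBox (L * M)) = ∑ y ∈ periodBox M, ∑ κ : Fin d, ‖ψ (faceSite L y κ) κ‖ ^ 2 := by
  unfold T4AveragingDeficitWall.dirSq
  rw [← blockSites_periodBox L M hL, ← sum_blocks_eq L hL (periodBox M) (fun z => ∑ κ : Fin d, ‖ψ z κ‖ ^ 2)]
  refine Finset.sum_congr rfl fun y _ => ?_
  rw [Finset.sum_comm]
  refine Finset.sum_congr rfl fun κ _ => ?_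
  rw [Finset.sum_eq_single (faceOff L hL κ)]
  · rw [smul_add_boxVec_faceOff hL]
  · intro r _ hr
    rw [hψ _ _ fun hf => hr (eq_faceOff_of_isFaceBond hL y κ hf), norm_zero]
    ring
  · intro h; exact absurd (Finset.mem_univ _) h

/-! ## §3 R2ᴱ on the torus -/

/-- The coarse `ℓ¹` norm of coarse data over one period. [folklore] -/
def coarseL1 (M : ℕ) (φ : Site d → Fin d → 𝕄) : ℝ := ∑ y ∈ periodBox M, ∑ κ : Fin d, ‖φ y κ‖

/-- The coarse squared `ℓ²` norm of coarse data over one period. [folklore] -/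
def coarseSq (M : ℕ) (φ : Site d → Fin d → 𝕄) : ℝ := ∑ y ∈ periodBox M, ∑ κ : Fin d, ‖φ y κ‖ ^ 2

/-- `coarseL1 ≥ 0`. [folklore] -/
theorem coarseL1_nonneg (M : ℕ) (φ : Site d → Fin d → 𝕄) : 0 ≤ coarseL1 M φ := by unfold coarseL1; positivity

/-- `coarseSq ≥ 0`. [folklore] -/
theorem coarseSq_nonneg (M : ℕ) (φ : Site d → Fin d → 𝕄) : 0 ≤ coarseSq M φ := by unfold coarseSq; positivity

/-- **The coarse Wilson action sees a coarse direction field only at the block corners**: fields agreeing at every `Ly`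
give the same `s ↦ A^L(W e^{sΦ})`. [folklore] -/
theorem coarseActionOf_vary_congr (L : ℕ) (W : Site d → Fin d → 𝕄ˣ) {Φ Φ' : Site d → Fin d → 𝕄}
    (h : ∀ (y : Site d) (κ : Fin d), Φ ((L : ℤ) • y) κ = Φ' ((L : ℤ) • y) κ) (s : ℝ) (Wc : Finset (T4AveragingDeficitWall.Plaq d)) :
    coarseActionOf L (vary W Φ s) Wc = coarseActionOf L (vary W Φ' s) Wc := by
  unfold coarseActionOf
  refine Finset.sum_congr rfl fun P _ => ?_
  have key : ∀ (y : Site d) (κ : Fin d), vary W Φ s ((L : ℤ) • y) κ = vary W Φ' s ((L : ℤ) • y) κ := fun y κ => by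
    simp only [vary, h y κ]
  simp only [cplaq, ← smul_add, key]

/-- FINE CRITICALITY ALONG LIFTED DIRECTIONS (hypothesis shape; the Fermat / admissibility item R0 of the record — NOT
proved here): the periodic `U(N)` configuration `V` is critical for the fine Wilson action of the period along every
PERIODIC, FACE-SUPPORTED `𝔲(N)` direction whose push-forward is an admissible coarse direction (`Tc`).
[cite: Balaban1985Variational, (75)–(76) p.289, (83) p.290, §E (115)–(121) p.295] -/
def FineCritical (L M : ℕ) (V : Site d → Fin d → 𝕄ˣ) (Tc : (Site d → Fin d → 𝕄) → Prop) : Prop :=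
  ∀ ψ : Site d → Fin d → 𝕄, IsSkewDir ψ → IsPeriodicDir ψ ((L : ℤ) * M) → FaceSupported L ψ →
    Tc (fun y κ => pushDir L V ψ ((L : ℤ) • y) κ) →
      HasDerivAt (fun s : ℝ => fineAction (vary V ψ s) (blockWindow L (periodBox M)).2) 0 0

/-- NON-VACUITY of the hypothesis shape: the FLAT configuration is critical for the fine Wilson action along every
`𝔲(N)` direction (`d/ds|₀ Σ(1 − Re tr V_s(∂p)) = −Σ Re tr((d_Vψ)(p)) = 0`, the dressed curl being skew), so
`FineCritical L M 1 Tc` holds for every admissibility predicate `Tc`. [folklore] -/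
theorem fineCritical_flat [Nonempty n] (L M : ℕ) (Tc : (Site d → Fin d → 𝕄) → Prop) :
    FineCritical L M (fun (_ : Site d) (_ : Fin d) => (1 : 𝕄ˣ)) Tc := by
  intro ψ hψ _ _ _
  have h := hasDerivAt_fineAction_vary (fun (_ : Site d) (_ : Fin d) => (1 : 𝕄ˣ)) ψ (blockWindow L (periodBox M)).2
  have h0 : ∑ p ∈ (blockWindow L (periodBox (d := d) M)).2,
      nReTr (curl (fun (_ : Site d) (_ : Fin d) => (1 : 𝕄ˣ)) ψ p
        * (((fhol (fun (_ : Site d) (_ : Fin d) => (1 : 𝕄ˣ)) p : 𝕄ˣ)) : 𝕄)) = 0 := by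
    refine Finset.sum_eq_zero fun p _ => ?_
    have hu : IsUnitaryCfg (fun (_ : Site d) (_ : Fin d) => (1 : 𝕄ˣ)) := fun _ _ => (unitaryUnits 𝕄).one_mem
    rw [fhol, hol_flat, Units.val_one, mul_one]
    exact nReTr_eq_zero_of_mem_skewAdjoint (curl_mem_skewAdjoint hu hψ p)
  rw [h0, neg_zero] at h
  exact h

/-- The constant of the `ℓ²` slot. [folklore] -/
def dualC2 (d L : ℕ) : ℝ := 2 * (L : ℝ) ^ d * Real.sqrt (8 * Fintype.card (T4AveragingDeficitWall.Plane d))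

/-- The constant of the `ℓ¹` slot. [folklore] -/
def dualC1 (d L : ℕ) : ℝ := 2 * (L : ℝ) ^ d * (1 + 2 * Fintype.card (T4AveragingDeficitWall.Plane d))

set_option maxHeartbeats 800000 in
/-- **R2ᴱ ON THE TORUS FOR BAŁABAN'S NON-LINEAR AVERAGE** (β-per + residual pairing + periodic lift BY NAME; fine criticality
as the hypothesis `FineCritical`): for every `M ≥ 1`, every `U(N)`-valued `V` of period `L·M` in the small-field class
`|V(∂p) − 1| ≤ a`, `liftSmall d L·a ≤ 1`, critical along lifted directions with admissible push-forward (`Tc`), every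
PERIODIC coarse `𝔲(N)` direction `φ` with `Tc φ`, every coarse direction field `Φ` on the fine lattice agreeing with `φ`
at the block corners, and every derivative `D_c` at `0` of `s ↦ A^L_{[0,M)^d}(V̄ e^{sΦ})`:
`L^{d−4}|D_c| ≤ wallConst·[‖∇_VF‖_{ℓ²(period)}·dualC2·‖φ‖_{ℓ²} + a²·dualC1·‖φ‖_{ℓ¹}]`.  Dictionary: `V = U_{k+1}(V′)`,
`V̄ = W_k(V′)`, `D_c = ⟨J(W_k(V′)), φ⟩`, `φ ∈ T` [cite: Balaban1985Variational, (26)–(27) p.282]. [folklore] -/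
theorem dualResidual_torus [Nonempty n] {L : ℕ} (hL : 1 ≤ L) {M : ℕ} (hM : 1 ≤ M) {V : Site d → Fin d → 𝕄ˣ}
    (hV : IsUnitaryCfg V) (hVP : IsPeriodicCfg V ((L : ℤ) * M)) {a : ℝ} (ha : 0 ≤ a) (hsmall : liftSmall d L * a ≤ 1)
    (hVa : SmallField V a) {Tc : (Site d → Fin d → 𝕄) → Prop} (hcrit : FineCritical L M V Tc)
    (φ : Site d → Fin d → 𝕄) (hφs : ∀ (y : Site d) (κ : Fin d), φ y κ ∈ skewAdjoint 𝕄)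
    (hφP : ∀ (y : Site d) (j κ : Fin d), φ (y + (M : ℤ) • e j) κ = φ y κ) (hφT : Tc φ)
    (Φ : Site d → Fin d → 𝕄) (hΦ : ∀ (y : Site d) (κ : Fin d), Φ ((L : ℤ) • y) κ = φ y κ) {Dc : ℝ}
    (hDc : HasDerivAt (fun s : ℝ => coarseActionOf L (vary (bavg L V) Φ s) (blockWindow L (periodBox M)).1) Dc 0) :
    (L : ℝ) ^ ((d : ℤ) - 4) * |Dc|
      ≤ wallConst d L * (Real.sqrt (gradFluxSq V (blockSites L (periodBox M))) * (dualC2 d L * Real.sqrt (coarseSq M φ))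
          + a ^ 2 * (dualC1 d L * coarseL1 M φ)) := by
  have hL1 : (1 : ℝ) ≤ L := by exact_mod_cast hL
  have hLd : (1 : ℝ) ≤ (L : ℝ) ^ d := one_le_pow₀ hL1
  have hd0 : (0 : ℝ) ≤ d := Nat.cast_nonneg d
  have hLM : 1 ≤ L * M := Nat.one_le_iff_ne_zero.mpr (Nat.mul_ne_zero (by omega) (by omega))
  -- the B7 smallness from `liftSmall`
  have ha₀ : a ≤ 1 / (512 * (d + 1) * (d + 4) * (L : ℝ) ^ 2) := by
    have hK : (0 : ℝ) < 512 * (d + 1) * (d + 4) * (L : ℝ) ^ 2 := by positivity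
    rw [le_div_iff₀ hK]
    unfold liftSmall at hsmall
    have hpow : (L : ℝ) ^ (d + 2) = (L : ℝ) ^ d * (L : ℝ) ^ 2 := by ring
    rw [hpow] at hsmall
    have h0 : 0 ≤ ((d : ℝ) + 1) * ((d : ℝ) + 4) * (L : ℝ) ^ 2 * a := by positivity
    nlinarith
  -- the periodic lift of `φ`
  obtain ⟨ψ, hψF, hψP, hψpush, hψn, hψs⟩ := exists_lift_periodic hL hV hVP ha hsmall hVa φ hφP
  have hψskew : IsSkewDir ψ := hψs hφs
  -- fine criticality along `ψ`
  have hpushφ : (fun y κ => pushDir L V ψ ((L : ℤ) • y) κ) = φ := by funext y κ; exact hψpush y κ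
  have hcritψ := hcrit ψ hψskew hψP hψF (by rw [hpushφ]; exact hφT)
  -- the derivative along `Φ` is the derivative along `pushDir L V ψ`
  have hDc' : HasDerivAt
      (fun s : ℝ => coarseActionOf L (vary (bavg L V) (pushDir L V ψ) s) (blockWindow L (periodBox M)).1) Dc 0 := by
    refine hDc.congr_of_eventuallyEq (Filter.Eventually.of_forall fun s => ?_)
    exact coarseActionOf_vary_congr L (bavg L V) (fun y κ => by rw [hψpush, hΦ]) s _
  have key := residualPairing_torus L hL hM hV hVP ha ha₀ hVa hψskew hψP hcritψ hDc'
  -- the norms of `ψ` over one period against those of `φ`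
  set F : Finset (Site d) := blockSites L (periodBox M) with hF
  have hFeq : F = periodBox (L * M) := blockSites_periodBox L M hL
  have hψP' : IsPeriodicDir ψ ((L * M : ℕ) : ℤ) := by rw [natCast_mul_period]; exact hψP
  have hdirL1 : dirL1 ψ F ≤ 2 * (L : ℝ) ^ d * coarseL1 M φ := by
    rw [hFeq, dirL1_faceSupported_eq hL M hψF, coarseL1, Finset.mul_sum]
    refine Finset.sum_le_sum fun y _ => ?_
    rw [Finset.mul_sum]
    exact Finset.sum_le_sum fun κ _ => hψn y κ
  have hdirSq : dirSq ψ F ≤ (2 * (L : ℝ) ^ d) ^ 2 * coarseSq M φ := by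
    rw [hFeq, dirSq_faceSupported_eq hL M hψF, coarseSq, Finset.mul_sum]
    refine Finset.sum_le_sum fun y _ => ?_
    rw [Finset.mul_sum]
    refine Finset.sum_le_sum fun κ _ => ?_
    rw [← mul_pow]
    exact pow_le_pow_left₀ (norm_nonneg _) (hψn y κ) 2
  have hcurlL1 : curlL1 V ψ F ≤ 2 * Fintype.card (T4AveragingDeficitWall.Plane d) * dirL1 ψ F := by
    rw [hFeq]; exact curlL1_le_periodic hV hLM hψP'
  have hcurlSq : curlSq V ψ F ≤ 8 * Fintype.card (T4AveragingDeficitWall.Plane d) * dirSq ψ F := by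
    rw [hFeq]; exact curlSq_le_periodic hV hLM hψP'
  -- the `ℓ²` slot
  have hP0 : (0 : ℝ) ≤ Fintype.card (T4AveragingDeficitWall.Plane d) := Nat.cast_nonneg _
  have h2 : Real.sqrt (curlSq V ψ F) ≤ dualC2 d L * Real.sqrt (coarseSq M φ) := by
    have h := Real.sqrt_le_sqrt (hcurlSq.trans (mul_le_mul_of_nonneg_left hdirSq (by positivity)))
    refine h.trans (le_of_eq ?_)
    rw [dualC2, show 8 * (Fintype.card (T4AveragingDeficitWall.Plane d) : ℝ) * ((2 * (L : ℝ) ^ d) ^ 2 * coarseSq M φ)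
      = (8 * Fintype.card (T4AveragingDeficitWall.Plane d)) * (2 * (L : ℝ) ^ d) ^ 2 * coarseSq M φ by ring,
      Real.sqrt_mul (by positivity), Real.sqrt_mul (by positivity), Real.sqrt_sq (by positivity)]
    ring
  -- the `ℓ¹` slot
  have h1 : dirL1 ψ F + curlL1 V ψ F ≤ dualC1 d L * coarseL1 M φ := by
    have hc0 := coarseL1_nonneg M φ
    calc dirL1 ψ F + curlL1 V ψ F
        ≤ dirL1 ψ F + 2 * Fintype.card (T4AveragingDeficitWall.Plane d) * dirL1 ψ F := add_le_add le_rfl hcurlL1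
      _ = (1 + 2 * Fintype.card (T4AveragingDeficitWall.Plane d)) * dirL1 ψ F := by ring
      _ ≤ (1 + 2 * Fintype.card (T4AveragingDeficitWall.Plane d)) * (2 * (L : ℝ) ^ d * coarseL1 M φ) :=
          mul_le_mul_of_nonneg_left hdirL1 (by positivity)
      _ = dualC1 d L * coarseL1 M φ := by rw [dualC1]; ring
  -- assemble
  refine key.trans (mul_le_mul_of_nonneg_left ?_ (wallConst_nonneg d L))
  have hg : 0 ≤ Real.sqrt (gradFluxSq V F) := Real.sqrt_nonneg _
  exact add_le_add (mul_le_mul_of_nonneg_left h2 hg) (mul_le_mul_of_nonneg_left h1 (sq_nonneg a))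

/-- `‖φ‖_{ℓ¹(period)} ≤ √(d·M^d)·‖φ‖_{ℓ²(period)}` (Cauchy–Schwarz over the `d·M^d` coarse bonds of one period). [folklore] -/
theorem coarseL1_le_sqrt (M : ℕ) (φ : Site d → Fin d → 𝕄) :
    coarseL1 M φ ≤ Real.sqrt ((d : ℝ) * (M : ℝ) ^ d) * Real.sqrt (coarseSq M φ) := by
  have h1 : coarseL1 M φ ^ 2 ≤ ((d : ℝ) * (M : ℝ) ^ d) * coarseSq M φ := by
    unfold coarseL1 coarseSq
    rw [← Finset.sum_product', ← Finset.sum_product']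
    refine (sq_sum_le_card_mul_sum_sq (s := periodBox M ×ˢ (Finset.univ : Finset (Fin d)))
      (f := fun q => ‖φ q.1 q.2‖)).trans (le_of_eq ?_)
    rw [Finset.card_product, T4AveragingDeficitWallBoundary.card_periodBox, Finset.card_univ, Fintype.card_fin]
    push_cast
    ring
  have h2 := Real.sqrt_le_sqrt h1
  rw [Real.sqrt_sq (coarseL1_nonneg M φ), Real.sqrt_mul (by positivity)] at h2
  exact h2

/-- **R2ᴱ ON THE TORUS IN THE DUAL `ℓ²` NORM** (the shape `r ≤ ρ·√vol` of `T4ConvexResponse.actionRate_of_energyRoute`):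
under the hypotheses of `dualResidual_torus`,
`L^{d−4}|D_c| ≤ wallConst·[‖∇_VF‖_{ℓ²(period)}·dualC2 + a²·dualC1·√(d·M^d)]·‖φ‖_{ℓ²(period)}`. [folklore] -/
theorem dualResidual_torus_l2 [Nonempty n] {L : ℕ} (hL : 1 ≤ L) {M : ℕ} (hM : 1 ≤ M) {V : Site d → Fin d → 𝕄ˣ}
    (hV : IsUnitaryCfg V) (hVP : IsPeriodicCfg V ((L : ℤ) * M)) {a : ℝ} (ha : 0 ≤ a) (hsmall : liftSmall d L * a ≤ 1)
    (hVa : SmallField V a) {Tc : (Site d → Fin d → 𝕄) → Prop} (hcrit : FineCritical L M V Tc)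
    (φ : Site d → Fin d → 𝕄) (hφs : ∀ (y : Site d) (κ : Fin d), φ y κ ∈ skewAdjoint 𝕄)
    (hφP : ∀ (y : Site d) (j κ : Fin d), φ (y + (M : ℤ) • e j) κ = φ y κ) (hφT : Tc φ)
    (Φ : Site d → Fin d → 𝕄) (hΦ : ∀ (y : Site d) (κ : Fin d), Φ ((L : ℤ) • y) κ = φ y κ) {Dc : ℝ}
    (hDc : HasDerivAt (fun s : ℝ => coarseActionOf L (vary (bavg L V) Φ s) (blockWindow L (periodBox M)).1) Dc 0) :
    (L : ℝ) ^ ((d : ℤ) - 4) * |Dc|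
      ≤ wallConst d L * (Real.sqrt (gradFluxSq V (blockSites L (periodBox M))) * dualC2 d L
          + a ^ 2 * dualC1 d L * Real.sqrt ((d : ℝ) * (M : ℝ) ^ d)) * Real.sqrt (coarseSq M φ) := by
  have h := dualResidual_torus hL hM hV hVP ha hsmall hVa hcrit φ hφs hφP hφT Φ hΦ hDc
  have hL1 : (1 : ℝ) ≤ L := by exact_mod_cast hL
  have hC1 : 0 ≤ dualC1 d L := by unfold dualC1; positivity
  have h1 := mul_le_mul_of_nonneg_left (coarseL1_le_sqrt M φ) (mul_nonneg (sq_nonneg a) hC1)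
  refine h.trans ?_
  have hw := wallConst_nonneg d L
  have e : wallConst d L * (Real.sqrt (gradFluxSq V (blockSites L (periodBox M))) * dualC2 d L
          + a ^ 2 * dualC1 d L * Real.sqrt ((d : ℝ) * (M : ℝ) ^ d)) * Real.sqrt (coarseSq M φ)
      = wallConst d L * (Real.sqrt (gradFluxSq V (blockSites L (periodBox M))) * (dualC2 d L * Real.sqrt (coarseSq M φ))
          + a ^ 2 * dualC1 d L * (Real.sqrt ((d : ℝ) * (M : ℝ) ^ d) * Real.sqrt (coarseSq M φ))) := by ring
  rw [e]
  refine mul_le_mul_of_nonneg_left (add_le_add le_rfl ?_) hw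
  rw [mul_assoc (a ^ 2)] at h1
  exact h1

end

end Summit.QuantumFields.BalabanUV.T4Continuum.AveragingDeficitDualResidual
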